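import Mathlib
import HarnessLib
import Summits.HubbardSuperconductivity.HubbardSuperconductivity.Theorems.KLProgrammePerturbedFermiCurveTwoFrameBand
import Summits.HubbardSuperconductivity.HubbardSuperconductivity.Theorems.KLProgrammePerturbedFermiCurveTwoFrameTower4

/-!
# Route `KLProgramme` — two perturbed bands `ε₀ + δ`, `ε₀ + δ′`, orders THREE and FOUR: `|v‴ − u‴|`, `|v⁗ − u⁗|` LINEAR in
# `sup|δ′−δ|, sup‖Dʲδ′ − Dʲδ‖` (j ≤ 4), up to ONE non-Lipschitz term `2κ₄` at order four (BGM 2006 Lemma 2.1, two frames)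

Cell `gate-hubbard-kl`, seat hubbard-kl-k3c3-p3 (g3; row «implicit-function / monotonicity route»).  Continues `…TwoFrameBand` (p490611, orders
0–2) with the pointwise algebra of `…TwoFrameTower3/4` (p491085, p491533).  For the gen-5 ENGINE child `KLRegimeEngineV14`
(stmt-HubbardSuperconductivity-19918), stub `stub_twoLeg_step`, clause (E3a-MS) `TwoLegSizesMST` — recipe of record (L)+(F) (k3c3-p1
MS-DESIGN-NOTE §3; plan g12 GEN5-AUDIT-ANNEX row T-ms): the slot-`m` parts are differences of one increment read on the curves of two nearby
(level-shifted, frequency-split) frames; their order-3/4 sizes need these bounds, every term LINEAR in the added piece and its derivatives.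

* §1 `fderiv_three/_four_pertBand_sub` (nested-derivative splits), `norm_fderiv_three_pertBand_sub_le` (`D³(ε₀+δ)` is `(4+κ₄)`-Lipschitz on the
  closed square), `norm_fderiv_four_sqDispersion_sub_le` (`D⁴ε₀` is `4`-Lipschitz; `D⁴δ` is only bounded under `FrameOK`).
* §2 `norm_fderiv_three_two_roots_sub_le` (`Δ₃ ≤ (4+κ₄)W₀ + E₃`), `norm_fderiv_four_two_roots_sub_le` (`Δ₄ ≤ 4W₀ + 2κ₄ + E₄`),
  `abs_deriv_three_root_sub_le`, `abs_deriv_four_root_sub_le` (incremental: lower differences `W₁, W₂, W₃` and tower bounds as hypotheses).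

Everything is PROVED; no definitions; nothing about the Hubbard model.  References: BGM 2006 §2.4 Lemma 2.1 (2.40)
[cite: BenfattoGiulianiMastropietro2006]; FST IV (CPAM 53 (2000) 1350) Thm 2.
-/

noncomputable section

namespace Summit.HubbardSuperconductivity.HubbardSuperconductivity.Theorems.PerturbedFermiCurve

set_option linter.dupNamespace false -- summit = problem name (single-conjunct summit), D-0017
set_option maxSynthPendingDepth 4 -- nested operator-norm instances (up to the fifth Fréchet derivative of ε₀)

open Real Set
open Literature.MathematicalPhysics.QuantumLattice Literature.MathematicalPhysics.QuantumLattice.BandSectorCounting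

/-! ## §1 Nested-derivative splits at orders 3, 4; Lipschitz of `D³(ε₀+δ)` and of `D⁴ε₀` -/

section Splits

variable {δ δ' : (Fin 2 → ℝ) → ℝ} (hδs : ContDiff ℝ 4 δ) (hδs' : ContDiff ℝ 4 δ')
include hδs hδs'

omit hδs hδs' in
/-- `D²(ε₀+g) = D²ε₀ + D²g` as functions, for `g ∈ C⁴`. [folklore] -/
theorem fderiv_two_pertBand_eq {g : (Fin 2 → ℝ) → ℝ} (hg : ContDiff ℝ 4 g) :
    fderiv ℝ (fderiv ℝ (fun k : Fin 2 → ℝ => sqDispersion k + g k)) = fderiv ℝ (fderiv ℝ sqDispersion) + fderiv ℝ (fderiv ℝ g) := by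
  have h0 : Differentiable ℝ sqDispersion := (contDiff_sqDispersion (m := 1)).differentiable one_ne_zero
  have h1 : Differentiable ℝ g := hg.differentiable (by norm_num)
  have e1 : fderiv ℝ (fun k : Fin 2 → ℝ => sqDispersion k + g k) = fderiv ℝ sqDispersion + fderiv ℝ g := by
    funext y; exact fderiv_add (h0 y) (h1 y)
  have g0 : Differentiable ℝ (fderiv ℝ sqDispersion) :=
    ((contDiff_sqDispersion (m := 2)).fderiv_right (m := 1) (by norm_num)).differentiable one_ne_zero
  have g1 : Differentiable ℝ (fderiv ℝ g) := (hg.fderiv_right (m := 3) (by norm_num)).differentiable (by norm_num)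
  rw [e1]; funext y; exact fderiv_add (g0 y) (g1 y)

omit hδs hδs' in
/-- `D³(ε₀+g) = D³ε₀ + D³g` as functions, for `g ∈ C⁴`. [folklore] -/
theorem fderiv_three_pertBand_eq {g : (Fin 2 → ℝ) → ℝ} (hg : ContDiff ℝ 4 g) :
    fderiv ℝ (fderiv ℝ (fderiv ℝ (fun k : Fin 2 → ℝ => sqDispersion k + g k))) =
      fderiv ℝ (fderiv ℝ (fderiv ℝ sqDispersion)) + fderiv ℝ (fderiv ℝ (fderiv ℝ g)) := by
  rw [fderiv_two_pertBand_eq hg]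
  have g0 : Differentiable ℝ (fderiv ℝ (fderiv ℝ sqDispersion)) :=
    (((contDiff_sqDispersion (m := 3)).fderiv_right (m := 2) (by norm_num)).fderiv_right (m := 1) (by norm_num)).differentiable
      one_ne_zero
  have g1 : Differentiable ℝ (fderiv ℝ (fderiv ℝ g)) :=
    ((hg.fderiv_right (m := 3) (by norm_num)).fderiv_right (m := 2) (by norm_num)).differentiable (by norm_num)
  funext y; exact fderiv_add (g0 y) (g1 y)

omit hδs hδs' in
/-- `D⁴(ε₀+g) = D⁴ε₀ + D⁴g` as functions, for `g ∈ C⁴`. [folklore] -/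
theorem fderiv_four_pertBand_eq {g : (Fin 2 → ℝ) → ℝ} (hg : ContDiff ℝ 4 g) :
    fderiv ℝ (fderiv ℝ (fderiv ℝ (fderiv ℝ (fun k : Fin 2 → ℝ => sqDispersion k + g k)))) =
      fderiv ℝ (fderiv ℝ (fderiv ℝ (fderiv ℝ sqDispersion))) + fderiv ℝ (fderiv ℝ (fderiv ℝ (fderiv ℝ g))) := by
  rw [fderiv_three_pertBand_eq hg]
  have g0 : Differentiable ℝ (fderiv ℝ (fderiv ℝ (fderiv ℝ sqDispersion))) :=
    ((((contDiff_sqDispersion (m := 4)).fderiv_right (m := 3) (by norm_num)).fderiv_right (m := 2) (by norm_num)).fderiv_right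
      (m := 1) (by norm_num)).differentiable one_ne_zero
  have g1 : Differentiable ℝ (fderiv ℝ (fderiv ℝ (fderiv ℝ g))) :=
    (((hg.fderiv_right (m := 3) (by norm_num)).fderiv_right (m := 2) (by norm_num)).fderiv_right (m := 1) (by norm_num)).differentiable
      one_ne_zero
  funext y; exact fderiv_add (g0 y) (g1 y)

/-- `D³(ε₀ + δ′)(x) = D³(ε₀ + δ)(x) + (D³δ′(x) − D³δ(x))`. [folklore] -/
theorem fderiv_three_pertBand_sub (x : Fin 2 → ℝ) :
    fderiv ℝ (fderiv ℝ (fderiv ℝ (fun k : Fin 2 → ℝ => sqDispersion k + δ' k))) x =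
      fderiv ℝ (fderiv ℝ (fderiv ℝ (fun k : Fin 2 → ℝ => sqDispersion k + δ k))) x +
        (fderiv ℝ (fderiv ℝ (fderiv ℝ δ')) x - fderiv ℝ (fderiv ℝ (fderiv ℝ δ)) x) := by
  rw [fderiv_three_pertBand_eq hδs', fderiv_three_pertBand_eq hδs]
  simp only [Pi.add_apply]; abel

/-- `D⁴(ε₀ + δ′)(x) = D⁴(ε₀ + δ)(x) + (D⁴δ′(x) − D⁴δ(x))`. [folklore] -/
theorem fderiv_four_pertBand_sub (x : Fin 2 → ℝ) :
    fderiv ℝ (fderiv ℝ (fderiv ℝ (fderiv ℝ (fun k : Fin 2 → ℝ => sqDispersion k + δ' k)))) x =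
      fderiv ℝ (fderiv ℝ (fderiv ℝ (fderiv ℝ (fun k : Fin 2 → ℝ => sqDispersion k + δ k)))) x +
        (fderiv ℝ (fderiv ℝ (fderiv ℝ (fderiv ℝ δ'))) x - fderiv ℝ (fderiv ℝ (fderiv ℝ (fderiv ℝ δ))) x) := by
  rw [fderiv_four_pertBand_eq hδs', fderiv_four_pertBand_eq hδs]
  simp only [Pi.add_apply]; abel

omit hδs' in
/-- `‖D⁴(ε₀ + δ)(k)‖ ≤ 4 + κ₄` at every point of the closed square. [folklore] -/
theorem norm_fderiv_four_pertBand_le_of_mem {κ₄ : ℝ}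
    (hκ₄ : ∀ k : Fin 2 → ℝ, (∀ i, |k i| ≤ π) → ‖fderiv ℝ (fderiv ℝ (fderiv ℝ (fderiv ℝ δ))) k‖ ≤ κ₄) {k : Fin 2 → ℝ}
    (hk : ∀ i, |k i| ≤ π) : ‖fderiv ℝ (fderiv ℝ (fderiv ℝ (fderiv ℝ (fun k : Fin 2 → ℝ => sqDispersion k + δ k)))) k‖ ≤ 4 + κ₄ := by
  rw [norm_fderiv_four_eq_norm_iteratedFDeriv, show (fun k : Fin 2 → ℝ => sqDispersion k + δ k) = sqDispersion + δ from rfl,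
    iteratedFDeriv_add_apply contDiff_sqDispersion.contDiffAt hδs.contDiffAt]
  refine (norm_add_le _ _).trans (add_le_add (norm_iteratedFDeriv_sqDispersion_le 4 _) ?_)
  rw [← norm_fderiv_four_eq_norm_iteratedFDeriv]; exact hκ₄ _ hk

omit hδs' in
/-- **`D³(ε₀ + δ)` is `(4 + κ₄)`-Lipschitz on the closed square.** [folklore] -/
theorem norm_fderiv_three_pertBand_sub_le {κ₄ : ℝ}
    (hκ₄ : ∀ k : Fin 2 → ℝ, (∀ i, |k i| ≤ π) → ‖fderiv ℝ (fderiv ℝ (fderiv ℝ (fderiv ℝ δ))) k‖ ≤ κ₄)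
    {x y : Fin 2 → ℝ} (hx : ∀ i, |x i| ≤ π) (hy : ∀ i, |y i| ≤ π) :
    ‖fderiv ℝ (fderiv ℝ (fderiv ℝ (fun k : Fin 2 → ℝ => sqDispersion k + δ k))) x -
        fderiv ℝ (fderiv ℝ (fderiv ℝ (fun k : Fin 2 → ℝ => sqDispersion k + δ k))) y‖ ≤ (4 + κ₄) * ‖x - y‖ := by
  have hC : ContDiff ℝ 1 (fderiv ℝ (fderiv ℝ (fderiv ℝ (fun k : Fin 2 → ℝ => sqDispersion k + δ k)))) :=
    (((contDiff_pertBand hδs).fderiv_right (m := 3) (by norm_num)).fderiv_right (m := 2) (by norm_num)).fderiv_right (by norm_num)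
  exact (convex_closedSquare).norm_image_sub_le_of_norm_fderiv_le (fun z _ => (hC.differentiable one_ne_zero) z)
    (fun z hz => norm_fderiv_four_pertBand_le_of_mem hδs hκ₄ hz) hy hx

omit hδs hδs' in
/-- **`D⁴ε₀` is `4`-Lipschitz** (everywhere). [folklore] -/
theorem norm_fderiv_four_sqDispersion_sub_le (x y : Fin 2 → ℝ) :
    ‖fderiv ℝ (fderiv ℝ (fderiv ℝ (fderiv ℝ sqDispersion))) x - fderiv ℝ (fderiv ℝ (fderiv ℝ (fderiv ℝ sqDispersion))) y‖ ≤
      4 * ‖x - y‖ := by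
  set g := fderiv ℝ sqDispersion with hg
  have hgC : ContDiff ℝ 5 g := (contDiff_sqDispersion (m := 6)).fderiv_right (by norm_num)
  have hC : ContDiff ℝ 2 (fderiv ℝ (fderiv ℝ (fderiv ℝ g))) :=
    ((hgC.fderiv_right (m := 4) (by norm_num)).fderiv_right (m := 3) (by norm_num)).fderiv_right (by norm_num)
  have hb : ∀ z : Fin 2 → ℝ, ‖fderiv ℝ (fderiv ℝ (fderiv ℝ (fderiv ℝ g))) z‖ ≤ 4 := fun z => by
    rw [norm_fderiv_four_eq_norm_iteratedFDeriv, hg, norm_iteratedFDeriv_fderiv]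
    exact norm_iteratedFDeriv_sqDispersion_le 5 z
  have h := (convex_univ).norm_image_sub_le_of_norm_fderiv_le (f := fderiv ℝ (fderiv ℝ (fderiv ℝ g))) (𝕜 := ℝ)
    (fun z _ => (hC.differentiable (by norm_num)) z) (fun z _ => hb z) (mem_univ y) (mem_univ x)
  simpa [hg] using h

end Splits

/-! ## §2 Two root selections: `Δ₃`, `Δ₄` and orders three, four -/

section TwoBands

variable {a b : ℝ} (B : BandBounds a b) {δ δ' : (Fin 2 → ℝ) → ℝ} (hδs : ContDiff ℝ 4 δ) (hδs' : ContDiff ℝ 4 δ')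
  {κ₀ κ₁ μ : ℝ} (hδ : ∀ k : Fin 2 → ℝ, (∀ i, |k i| ≤ π) → |δ k| ≤ κ₀) (hδ' : ∀ k : Fin 2 → ℝ, (∀ i, |k i| ≤ π) → |δ' k| ≤ κ₀)
  (hlo : a ≤ μ - κ₀) (hhi : μ + κ₀ ≤ b)
  (hκ : ∀ k : Fin 2 → ℝ, (∀ i, |k i| ≤ π) → ‖fderiv ℝ δ k‖ ≤ κ₁) (hκ' : ∀ k : Fin 2 → ℝ, (∀ i, |k i| ≤ π) → ‖fderiv ℝ δ' k‖ ≤ κ₁)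
  (hκ₁ : κ₁ < B.Dtmin)
  {u v : ℝ → ℝ} (hu : ∀ θ, IsBandFermiRadius (μ - δ (u θ • dir θ)) θ (u θ)) (hv : ∀ θ, IsBandFermiRadius (μ - δ' (v θ • dir θ)) θ (v θ))
  {E₀ : ℝ} (hE₀ : ∀ k : Fin 2 → ℝ, (∀ i, |k i| ≤ π) → |δ' k - δ k| ≤ E₀)
include B hδs hδs' hδ hδ' hlo hhi hκ hκ' hκ₁ hu hv hE₀

omit hκ' in
/-- **Δ₃**: `‖D³(ε₀+δ′)(v·dir) − D³(ε₀+δ)(u·dir)‖ ≤ (4+κ₄)·E₀/(Dt_min−κ₁) + E₃`. [folklore] -/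
theorem norm_fderiv_three_two_roots_sub_le {κ₄ E₃ : ℝ}
    (hκ₄ : ∀ k : Fin 2 → ℝ, (∀ i, |k i| ≤ π) → ‖fderiv ℝ (fderiv ℝ (fderiv ℝ (fderiv ℝ δ))) k‖ ≤ κ₄)
    (hE₃ : ∀ k : Fin 2 → ℝ, (∀ i, |k i| ≤ π) →
      ‖fderiv ℝ (fderiv ℝ (fderiv ℝ δ')) k - fderiv ℝ (fderiv ℝ (fderiv ℝ δ)) k‖ ≤ E₃) (θ : ℝ) :
    ‖fderiv ℝ (fderiv ℝ (fderiv ℝ (fun k : Fin 2 → ℝ => sqDispersion k + δ' k))) (v θ • dir θ) -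
        fderiv ℝ (fderiv ℝ (fderiv ℝ (fun k : Fin 2 → ℝ => sqDispersion k + δ k))) (u θ • dir θ)‖ ≤
      (4 + κ₄) * (E₀ / (B.Dtmin - κ₁)) + E₃ := by
  have hsv := abs_apply_le_pi_of_isBandFermiRadius (hv θ)
  have hsu := abs_apply_le_pi_of_isBandFermiRadius (hu θ)
  rw [fderiv_three_pertBand_sub hδs hδs' (v θ • dir θ)]
  have e : fderiv ℝ (fderiv ℝ (fderiv ℝ (fun k : Fin 2 → ℝ => sqDispersion k + δ k))) (v θ • dir θ) +
        (fderiv ℝ (fderiv ℝ (fderiv ℝ δ')) (v θ • dir θ) - fderiv ℝ (fderiv ℝ (fderiv ℝ δ)) (v θ • dir θ)) -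
      fderiv ℝ (fderiv ℝ (fderiv ℝ (fun k : Fin 2 → ℝ => sqDispersion k + δ k))) (u θ • dir θ) =
      (fderiv ℝ (fderiv ℝ (fderiv ℝ (fun k : Fin 2 → ℝ => sqDispersion k + δ k))) (v θ • dir θ) -
        fderiv ℝ (fderiv ℝ (fderiv ℝ (fun k : Fin 2 → ℝ => sqDispersion k + δ k))) (u θ • dir θ)) +
        (fderiv ℝ (fderiv ℝ (fderiv ℝ δ')) (v θ • dir θ) - fderiv ℝ (fderiv ℝ (fderiv ℝ δ)) (v θ • dir θ)) := by abel
  rw [e]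
  refine (norm_add_le _ _).trans (add_le_add ?_ (hE₃ _ hsv))
  have hκ₄0 : 0 ≤ 4 + κ₄ := by
    have := (ContinuousLinearMap.opNorm_nonneg (fderiv ℝ (fderiv ℝ (fderiv ℝ (fderiv ℝ δ))) (u θ • dir θ))).trans (hκ₄ _ hsu)
    linarith
  exact (norm_fderiv_three_pertBand_sub_le hδs hκ₄ hsv hsu).trans
    (mul_le_mul_of_nonneg_left (norm_root_smul_sub_le B hδs hδ hδ' hlo hhi hκ hκ₁ hu hv hE₀ θ) hκ₄0)

omit hκ' in
/-- **Δ₄** (the one non-Lipschitz entry): `‖D⁴(ε₀+δ′)(v·dir) − D⁴(ε₀+δ)(u·dir)‖ ≤ 4·E₀/(Dt_min−κ₁) + 2κ₄ + E₄` — `D⁴ε₀` is Lipschitz,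
`D⁴δ` is only bounded by `κ₄` at both points. [folklore] -/
theorem norm_fderiv_four_two_roots_sub_le {κ₄ E₄ : ℝ}
    (hκ₄ : ∀ k : Fin 2 → ℝ, (∀ i, |k i| ≤ π) → ‖fderiv ℝ (fderiv ℝ (fderiv ℝ (fderiv ℝ δ))) k‖ ≤ κ₄)
    (hE₄ : ∀ k : Fin 2 → ℝ, (∀ i, |k i| ≤ π) →
      ‖fderiv ℝ (fderiv ℝ (fderiv ℝ (fderiv ℝ δ'))) k - fderiv ℝ (fderiv ℝ (fderiv ℝ (fderiv ℝ δ))) k‖ ≤ E₄) (θ : ℝ) :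
    ‖fderiv ℝ (fderiv ℝ (fderiv ℝ (fderiv ℝ (fun k : Fin 2 → ℝ => sqDispersion k + δ' k)))) (v θ • dir θ) -
        fderiv ℝ (fderiv ℝ (fderiv ℝ (fderiv ℝ (fun k : Fin 2 → ℝ => sqDispersion k + δ k)))) (u θ • dir θ)‖ ≤
      4 * (E₀ / (B.Dtmin - κ₁)) + 2 * κ₄ + E₄ := by
  have hsv := abs_apply_le_pi_of_isBandFermiRadius (hv θ)
  have hsu := abs_apply_le_pi_of_isBandFermiRadius (hu θ)
  set p := u θ • dir θ with hp
  set q := v θ • dir θ with hq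
  rw [fderiv_four_pertBand_sub hδs hδs' q, fderiv_four_pertBand_eq hδs]
  simp only [Pi.add_apply]
  have e : fderiv ℝ (fderiv ℝ (fderiv ℝ (fderiv ℝ sqDispersion))) q + fderiv ℝ (fderiv ℝ (fderiv ℝ (fderiv ℝ δ))) q +
        (fderiv ℝ (fderiv ℝ (fderiv ℝ (fderiv ℝ δ'))) q - fderiv ℝ (fderiv ℝ (fderiv ℝ (fderiv ℝ δ))) q) -
      (fderiv ℝ (fderiv ℝ (fderiv ℝ (fderiv ℝ sqDispersion))) p + fderiv ℝ (fderiv ℝ (fderiv ℝ (fderiv ℝ δ))) p) =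
      (fderiv ℝ (fderiv ℝ (fderiv ℝ (fderiv ℝ sqDispersion))) q - fderiv ℝ (fderiv ℝ (fderiv ℝ (fderiv ℝ sqDispersion))) p) +
        (fderiv ℝ (fderiv ℝ (fderiv ℝ (fderiv ℝ δ))) q - fderiv ℝ (fderiv ℝ (fderiv ℝ (fderiv ℝ δ))) p) +
        (fderiv ℝ (fderiv ℝ (fderiv ℝ (fderiv ℝ δ'))) q - fderiv ℝ (fderiv ℝ (fderiv ℝ (fderiv ℝ δ))) q) := by abel
  rw [e]
  have h1 : ‖fderiv ℝ (fderiv ℝ (fderiv ℝ (fderiv ℝ sqDispersion))) q - fderiv ℝ (fderiv ℝ (fderiv ℝ (fderiv ℝ sqDispersion))) p‖ ≤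
      4 * (E₀ / (B.Dtmin - κ₁)) :=
    (norm_fderiv_four_sqDispersion_sub_le q p).trans
      (mul_le_mul_of_nonneg_left (norm_root_smul_sub_le B hδs hδ hδ' hlo hhi hκ hκ₁ hu hv hE₀ θ) (by norm_num))
  have h2 : ‖fderiv ℝ (fderiv ℝ (fderiv ℝ (fderiv ℝ δ))) q - fderiv ℝ (fderiv ℝ (fderiv ℝ (fderiv ℝ δ))) p‖ ≤ 2 * κ₄ := by
    refine (norm_sub_le (fderiv ℝ (fderiv ℝ (fderiv ℝ (fderiv ℝ δ))) q) (fderiv ℝ (fderiv ℝ (fderiv ℝ (fderiv ℝ δ))) p)).trans ?_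
    have := hκ₄ _ hsv; have := hκ₄ _ hsu; linarith
  have h3 := hE₄ _ hsv
  have h12 := norm_add_le
    (fderiv ℝ (fderiv ℝ (fderiv ℝ (fderiv ℝ sqDispersion))) q - fderiv ℝ (fderiv ℝ (fderiv ℝ (fderiv ℝ sqDispersion))) p)
    (fderiv ℝ (fderiv ℝ (fderiv ℝ (fderiv ℝ δ))) q - fderiv ℝ (fderiv ℝ (fderiv ℝ (fderiv ℝ δ))) p)
  have h123 := norm_add_le
    (fderiv ℝ (fderiv ℝ (fderiv ℝ (fderiv ℝ sqDispersion))) q - fderiv ℝ (fderiv ℝ (fderiv ℝ (fderiv ℝ sqDispersion))) p +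
      (fderiv ℝ (fderiv ℝ (fderiv ℝ (fderiv ℝ δ))) q - fderiv ℝ (fderiv ℝ (fderiv ℝ (fderiv ℝ δ))) p))
    (fderiv ℝ (fderiv ℝ (fderiv ℝ (fderiv ℝ δ'))) q - fderiv ℝ (fderiv ℝ (fderiv ℝ (fderiv ℝ δ))) q)
  linarith

/-- **ORDER 3, TWO FRAMES (incremental form).**  With `‖D²δ‖ ≤ κ₂`, `‖D³δ‖ ≤ κ₃`, `‖D⁴δ‖ ≤ κ₄`, `‖Dʲδ′ − Dʲδ‖ ≤ E_j` (j ≤ 3) on the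
closed square, common tower bounds `R₁, R₂` for `u, v` and `R₃ ≥ |u‴ θ|`, lower differences `W₁, W₂`, `W₀ = E₀/(Dt_min − κ₁)`,
`Δ_j = (4+κ_{j+1})W₀ + E_j`: `|v‴ θ − u‴ θ| ≤` the bound of `abs_deriv_three_sub_le_of_polar_levels` with `E_k = 4 + κ_k`, `U₀ = π√2`.
[cite: BenfattoGiulianiMastropietro2006, §2.4 Lemma 2.1 (2.40)] -/
theorem abs_deriv_three_root_sub_le {κ₂ κ₃ κ₄ E₁ E₂ E₃ : ℝ}
    (hκ₂ : ∀ k : Fin 2 → ℝ, (∀ i, |k i| ≤ π) → ‖fderiv ℝ (fderiv ℝ δ) k‖ ≤ κ₂)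
    (hκ₃ : ∀ k : Fin 2 → ℝ, (∀ i, |k i| ≤ π) → ‖fderiv ℝ (fderiv ℝ (fderiv ℝ δ)) k‖ ≤ κ₃)
    (hκ₄ : ∀ k : Fin 2 → ℝ, (∀ i, |k i| ≤ π) → ‖fderiv ℝ (fderiv ℝ (fderiv ℝ (fderiv ℝ δ))) k‖ ≤ κ₄)
    (hE₁ : ∀ k : Fin 2 → ℝ, (∀ i, |k i| ≤ π) → ‖fderiv ℝ δ' k - fderiv ℝ δ k‖ ≤ E₁)
    (hE₂ : ∀ k : Fin 2 → ℝ, (∀ i, |k i| ≤ π) → ‖fderiv ℝ (fderiv ℝ δ') k - fderiv ℝ (fderiv ℝ δ) k‖ ≤ E₂)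
    (hE₃ : ∀ k : Fin 2 → ℝ, (∀ i, |k i| ≤ π) →
      ‖fderiv ℝ (fderiv ℝ (fderiv ℝ δ')) k - fderiv ℝ (fderiv ℝ (fderiv ℝ δ)) k‖ ≤ E₃)
    {θ R₁ R₂ R₃ W₁ W₂ : ℝ} (hR₁ : |deriv u θ| ≤ R₁) (hR₁' : |deriv v θ| ≤ R₁) (hR₂ : |deriv (deriv u) θ| ≤ R₂)
    (hR₂' : |deriv (deriv v) θ| ≤ R₂) (hR₃ : |deriv (deriv (deriv u)) θ| ≤ R₃)
    (hW₁ : |deriv v θ - deriv u θ| ≤ W₁) (hW₂ : |deriv (deriv v) θ - deriv (deriv u) θ| ≤ W₂) :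
    |deriv (deriv (deriv v)) θ - deriv (deriv (deriv u)) θ| ≤
      (((4 + κ₄) * (E₀ / (B.Dtmin - κ₁)) + E₃) * (R₁ + π * Real.sqrt 2) ^ 3 +
        3 * (4 + κ₃) * (W₁ + E₀ / (B.Dtmin - κ₁)) * (R₁ + π * Real.sqrt 2) ^ 2 +
        3 * (((4 + κ₃) * (E₀ / (B.Dtmin - κ₁)) + E₂) * (R₁ + π * Real.sqrt 2) * (R₂ + 2 * R₁ + π * Real.sqrt 2) +
          (4 + κ₂) * ((W₂ + 2 * W₁ + E₀ / (B.Dtmin - κ₁)) * (R₁ + π * Real.sqrt 2) +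
            (R₂ + 2 * R₁ + π * Real.sqrt 2) * (W₁ + E₀ / (B.Dtmin - κ₁)))) +
        ((4 + κ₂) * (E₀ / (B.Dtmin - κ₁)) + E₁) * (3 * R₂ + 3 * R₁ + π * Real.sqrt 2) +
        (4 + κ₁) * (3 * W₂ + 3 * W₁ + E₀ / (B.Dtmin - κ₁)) + R₃ * ((4 + κ₂) * (E₀ / (B.Dtmin - κ₁)) + E₁)) / (B.Dtmin - κ₁) :=
  abs_deriv_three_sub_le_of_polar_levels (contDiff_pertBand hδs) (contDiff_pertBand hδs')
    (contDiff_four_of_isRoot B hδs hδ hlo hhi hκ hκ₁ hu) (contDiff_four_of_isRoot B hδs' hδ' hlo hhi hκ' hκ₁ hv)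
    (pertBand_level hu) (pertBand_level hv) (sub_pos.2 hκ₁)
    (Dtmin_sub_le_fderiv_pertBand_dir B hδ' hlo hhi hκ' hv hδs' θ) (norm_fderiv_pertBand_le hδs hκ hu θ)
    (norm_fderiv_two_pertBand_le hδs hu hκ₂ θ) (norm_fderiv_three_pertBand_le hδs hu hκ₃ θ)
    (norm_fderiv_two_roots_sub_le B hδs hδs' hδ hδ' hlo hhi hκ hκ₁ hu hv hE₀ hκ₂ hE₁ θ)
    (norm_fderiv_two_two_roots_sub_le B hδs hδs' hδ hδ' hlo hhi hκ hκ₁ hu hv hE₀ hκ₃ hE₂ θ)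
    (norm_fderiv_three_two_roots_sub_le B hδs hδs' hδ hδ' hlo hhi hκ hκ₁ hu hv hE₀ hκ₄ hE₃ θ)
    (abs_root_le_pi_mul_sqrt_two B hδ hlo hhi hu θ) (abs_root_le_pi_mul_sqrt_two B hδ' hlo hhi hv θ) hR₁ hR₁' hR₂ hR₂' hR₃
    (abs_root_sub_root_le B hδs hδ hδ' hlo hhi hκ hκ₁ hu hv hE₀ θ) hW₁ hW₂

/-- **ORDER 4, TWO FRAMES (incremental form).**  As above with `‖D⁴δ′ − D⁴δ‖ ≤ E₄`, common `R₃`, `R₄ ≥ |u⁗ θ|`, `W₃`, and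
`Δ₄ = 4W₀ + 2κ₄ + E₄`: `|v⁗ θ − u⁗ θ| ≤` the bound of `abs_deriv_four_sub_le_of_polar_levels` with `E_k = 4 + κ_k`, `U₀ = π√2`.
[cite: BenfattoGiulianiMastropietro2006, §2.4 Lemma 2.1 (2.40)] -/
theorem abs_deriv_four_root_sub_le {κ₂ κ₃ κ₄ E₁ E₂ E₃ E₄ : ℝ}
    (hκ₂ : ∀ k : Fin 2 → ℝ, (∀ i, |k i| ≤ π) → ‖fderiv ℝ (fderiv ℝ δ) k‖ ≤ κ₂)
    (hκ₃ : ∀ k : Fin 2 → ℝ, (∀ i, |k i| ≤ π) → ‖fderiv ℝ (fderiv ℝ (fderiv ℝ δ)) k‖ ≤ κ₃)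
    (hκ₄ : ∀ k : Fin 2 → ℝ, (∀ i, |k i| ≤ π) → ‖fderiv ℝ (fderiv ℝ (fderiv ℝ (fderiv ℝ δ))) k‖ ≤ κ₄)
    (hE₁ : ∀ k : Fin 2 → ℝ, (∀ i, |k i| ≤ π) → ‖fderiv ℝ δ' k - fderiv ℝ δ k‖ ≤ E₁)
    (hE₂ : ∀ k : Fin 2 → ℝ, (∀ i, |k i| ≤ π) → ‖fderiv ℝ (fderiv ℝ δ') k - fderiv ℝ (fderiv ℝ δ) k‖ ≤ E₂)
    (hE₃ : ∀ k : Fin 2 → ℝ, (∀ i, |k i| ≤ π) →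
      ‖fderiv ℝ (fderiv ℝ (fderiv ℝ δ')) k - fderiv ℝ (fderiv ℝ (fderiv ℝ δ)) k‖ ≤ E₃)
    (hE₄ : ∀ k : Fin 2 → ℝ, (∀ i, |k i| ≤ π) →
      ‖fderiv ℝ (fderiv ℝ (fderiv ℝ (fderiv ℝ δ'))) k - fderiv ℝ (fderiv ℝ (fderiv ℝ (fderiv ℝ δ))) k‖ ≤ E₄)
    {θ R₁ R₂ R₃ R₄ W₁ W₂ W₃ : ℝ} (hR₁ : |deriv u θ| ≤ R₁) (hR₁' : |deriv v θ| ≤ R₁) (hR₂ : |deriv (deriv u) θ| ≤ R₂)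
    (hR₂' : |deriv (deriv v) θ| ≤ R₂) (hR₃ : |deriv (deriv (deriv u)) θ| ≤ R₃) (hR₃' : |deriv (deriv (deriv v)) θ| ≤ R₃)
    (hR₄ : |deriv (deriv (deriv (deriv u))) θ| ≤ R₄)
    (hW₁ : |deriv v θ - deriv u θ| ≤ W₁) (hW₂ : |deriv (deriv v) θ - deriv (deriv u) θ| ≤ W₂)
    (hW₃ : |deriv (deriv (deriv v)) θ - deriv (deriv (deriv u)) θ| ≤ W₃) :
    |deriv (deriv (deriv (deriv v))) θ - deriv (deriv (deriv (deriv u))) θ| ≤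
      ((4 * (E₀ / (B.Dtmin - κ₁)) + 2 * κ₄ + E₄) * (R₁ + π * Real.sqrt 2) ^ 4 +
        4 * (4 + κ₄) * (W₁ + E₀ / (B.Dtmin - κ₁)) * (R₁ + π * Real.sqrt 2) ^ 3 +
        6 * ((((4 + κ₄) * (E₀ / (B.Dtmin - κ₁)) + E₃) * (R₁ + π * Real.sqrt 2) ^ 2 * (R₂ + 2 * R₁ + π * Real.sqrt 2) +
          (4 + κ₃) * ((W₂ + 2 * W₁ + E₀ / (B.Dtmin - κ₁)) * (R₁ + π * Real.sqrt 2) ^ 2 +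
            2 * (R₁ + π * Real.sqrt 2) * (R₂ + 2 * R₁ + π * Real.sqrt 2) * (W₁ + E₀ / (B.Dtmin - κ₁))))) +
        3 * ((((4 + κ₃) * (E₀ / (B.Dtmin - κ₁)) + E₂) * (R₂ + 2 * R₁ + π * Real.sqrt 2) ^ 2 +
          2 * (4 + κ₂) * (R₂ + 2 * R₁ + π * Real.sqrt 2) * (W₂ + 2 * W₁ + E₀ / (B.Dtmin - κ₁)))) +
        4 * ((((4 + κ₃) * (E₀ / (B.Dtmin - κ₁)) + E₂) * (R₁ + π * Real.sqrt 2) * (R₃ + 3 * R₁ + 3 * R₂ + π * Real.sqrt 2) +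
          (4 + κ₂) * ((W₁ + E₀ / (B.Dtmin - κ₁)) * (R₃ + 3 * R₁ + 3 * R₂ + π * Real.sqrt 2) +
            (R₁ + π * Real.sqrt 2) * (W₃ + 3 * W₁ + 3 * W₂ + E₀ / (B.Dtmin - κ₁))))) +
        ((4 + κ₂) * (E₀ / (B.Dtmin - κ₁)) + E₁) * (6 * R₂ + 4 * R₃ + 4 * R₁ + π * Real.sqrt 2) +
        (4 + κ₁) * (6 * W₂ + 4 * W₃ + 4 * W₁ + E₀ / (B.Dtmin - κ₁)) +
        R₄ * ((4 + κ₂) * (E₀ / (B.Dtmin - κ₁)) + E₁)) / (B.Dtmin - κ₁) :=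
  abs_deriv_four_sub_le_of_polar_levels (contDiff_pertBand hδs) (contDiff_pertBand hδs')
    (contDiff_four_of_isRoot B hδs hδ hlo hhi hκ hκ₁ hu) (contDiff_four_of_isRoot B hδs' hδ' hlo hhi hκ' hκ₁ hv)
    (pertBand_level hu) (pertBand_level hv) (sub_pos.2 hκ₁)
    (Dtmin_sub_le_fderiv_pertBand_dir B hδ' hlo hhi hκ' hv hδs' θ) (norm_fderiv_pertBand_le hδs hκ hu θ)
    (norm_fderiv_two_pertBand_le hδs hu hκ₂ θ) (norm_fderiv_three_pertBand_le hδs hu hκ₃ θ) (norm_fderiv_four_pertBand_le hδs hu hκ₄ θ)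
    (norm_fderiv_two_roots_sub_le B hδs hδs' hδ hδ' hlo hhi hκ hκ₁ hu hv hE₀ hκ₂ hE₁ θ)
    (norm_fderiv_two_two_roots_sub_le B hδs hδs' hδ hδ' hlo hhi hκ hκ₁ hu hv hE₀ hκ₃ hE₂ θ)
    (norm_fderiv_three_two_roots_sub_le B hδs hδs' hδ hδ' hlo hhi hκ hκ₁ hu hv hE₀ hκ₄ hE₃ θ)
    (norm_fderiv_four_two_roots_sub_le B hδs hδs' hδ hδ' hlo hhi hκ hκ₁ hu hv hE₀ hκ₄ hE₄ θ)
    (abs_root_le_pi_mul_sqrt_two B hδ hlo hhi hu θ) (abs_root_le_pi_mul_sqrt_two B hδ' hlo hhi hv θ) hR₁ hR₁' hR₂ hR₂' hR₃ hR₃' hR₄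
    (abs_root_sub_root_le B hδs hδ hδ' hlo hhi hκ hκ₁ hu hv hE₀ θ) hW₁ hW₂ hW₃

end TwoBands

end Summit.HubbardSuperconductivity.HubbardSuperconductivity.Theorems.PerturbedFermiCurve

end
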